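import Summits.RiemannHypothesis.RiemannHypothesis.Theorems.TiltedLandingLaw421R3Lens1ToothDichotomy

/-! # TiltedLandingLaw421 — lens-1 «ToothDichotomyC» IMAGE v1: the law-candidates (ii′)/(iii′) of record — band-state binder + closed rest class

W-09 lens-1 (rh33346-lens-1 g10). WORD = director-rh g30 (CA1073)(2) + (CA1076)(1) («(ii′)/(iii′) WORDS OF RECORD ACCEPTED … GO TO IMAGE
«ToothDichotomyC»»); evidence C2 g58 ANSWER (S2) (ideators bus l.4110); brief `lens-1/scratch/g10/M-TARGET-ii.md` da372f12. ONE import = TREE #1275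
`…Theorems.TiltedLandingLaw421R3Lens1ToothDichotomy` ((ii) `ToothNestDichotomyQ` :87, (iii) `UmbrellaDichotomyQ` :116, `RestFactor4`,
`nl_branch_of_strict`, `nl_branch_absurd`, dispatchers :246/:258; carries #1271's `RestFactor`, `RVClass`, `DPlus`). Ns `RhW08.Lens1ToothNestUmbrella`
reopened. SUPPORT (K-only): no `sorry`, NO law asserted — 3 defs + 6 (K) theorems; COUNT unmoved; registry v14q′ untouched.
WHY (brief §0 ERRATUM-2, ruled (CA1073)(2)). (ii)/(iii) of #1275 AS TYPED lack the band-state binder `StTrkDQ … j T`: their branch 2 carries the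
range conjunct `|x − x₀| < (j+3)·R/2`, underivable inside the law without the window location of `T` (`nl_range` needs
`abs_re_sub_le_of_stTrkDQ`), so a window-escape shape (legal carpet at `x₀` + a far in-class cluster needing branch 2) is a plausible counter-model,
while the dispatchers :246/:258 HOLD `hT` (weakest-law rule (CA1011)(2)). (ii)/(iii) are no longer targets; the LAW-CANDIDATES OF RECORD are
(ii′)/(iii′): `StTrkDQ … j T →` after the frame (supplies `0 < Im T` and, by `nl_branch_of_strict`, the range).
THE CLASS (C2 ANSWER (S2), ruled (CA1076)(1)). No float census of a `K′`-functional exists; `κ₁` is PRICED, by the safety integral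
`Im K(w) = ∫₀^{Im w} Re K′(Re w + iy) dy ≤ κ₁·Im w/Im T²` (`K = H′/H` real on the axis) along the WHOLE vertical segment from the diameter — so the
class must give `H ≠ 0` and `Im T²·‖(H′/H)′‖ ≤ κ₁` on the CLOSED upper half of `T`'s Jensen disc, strip below 119's chord `Im T/16` and diameter
INCLUDED (`H ≠ 0` on the diameter = «the only zero of `f⁽ʲ⁾` on `T`'s closed Jensen interval is the tooth», true in every frame of record; the
`/16` floor bought nothing in any census): `RVClassC` (§1), C2's accepted v2 region. STRONGER class ⇒ WEAKER law (the class is supplied by the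
caller, never asserted): `toothNestDichotomyC_of_Q` / `umbrellaDichotomyC_of_Q`. HONEST LOOPHOLE (named, never probed): the bound is on the SIGNED
sum `Σ m·(z − ζ)⁻² + …`, so a cancelling pair of rest zeros straddling the region is not excluded pointwise — the brief's hygiene step (S2) owns it.
INSTANCE NUMBERS (ledger/floats, labelled, not certificates; brief §3(1)): at the top the link-start ledger is conjugate `1/2` + near tooth `≥ 4/5`
+ partner conjugate `≥ 1/4` inward vs the rest lift `≤ κ₁`, so no bad arc meets the top iff `κ₁ < 21/20` (`κ₁ = 1`: margin `1/20`; C2's priced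
`2/5`: `13/20`); registry instance `θ = 1/10`.
* §1 `RVClassC κ₁ T H`, `rvClass_of_rvClassC` (⇒ 119's `RVClass`; consumers `dichotomy_of_umbrellaA`, `succ_of_nearTooth` kept).
* §2 ★ `ToothNestDichotomyCQ θ κ₁` (ii′), ★ `UmbrellaDichotomyCQ θ κ₁` (iii′) — branches VERBATIM as #1275 :87 —, `toothNestDichotomyC_of_Q`,
  `umbrellaDichotomyC_of_Q`, `toothNestDichotomyC_of_strict` (strict radius `|x − Re T| < 2·Im T`, no range conjunct, suffices).
* §3 dispatchers inside 2′: `succ_of_toothNestDichotomyC`, `succ_of_umbrellaDichotomyC` (= #1275 :246/:258 with `hT` passed WHOLE).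
HONEST LABEL: K bookkeeping over typed OPEN sentences; (ii′)/(iii′) are asserted by nothing; the brief's open inequality is (S7); nothing here
bears on the truth of RH; RH is not proved; ⟨33346⟩/⟨33347⟩ OPEN; stubs 1′/2/2′/3 OPEN; typed ≠ checked ≠ landed ≠ proved. -/

noncomputable section

open Complex Set
open scoped ComplexConjugate

namespace RhW08.Lens1ToothNestUmbrella

open RhIdea6.G17.W07C7 RhIdea6.G17.W07C7.Rev6 RhIdea6.G18.W07C8.Law421BirthS RhIdea6.G19.W07C11.Seam
open RhW08.Round1 RhW08.StSwap RhW08.Round2 RhW08.QuadW RhW08.SuccB RhW08.SuccSplit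

/-- RV_C(κ₁): on the CLOSED upper half of `T`'s Jensen disc (diameter included) `H ≠ 0` and `Im T²·‖(H′/H)′‖ ≤ κ₁` — the region of C2's
safety integral; the signed-sum cancellation loophole is NOT excluded by this Prop (see the module docstring). -/
def RVClassC (κ₁ : ℝ) (T : ℂ) (H : ℂ → ℂ) : Prop :=
  ∀ z : ℂ, (z.re - T.re) ^ 2 + z.im ^ 2 ≤ T.im ^ 2 → 0 ≤ z.im → H z ≠ 0 ∧ T.im ^ 2 * ‖deriv (fun w => deriv H w / H w) z‖ ≤ κ₁

/-- (K) the closed class contains 119's `RVClass` region `DPlus T` (`Im z ≥ Im T/16 ≥ 0`), so every `RVClass` consumer is kept. -/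
theorem rvClass_of_rvClassC {κ₁ : ℝ} {T : ℂ} {H : ℂ → ℂ} (hT : 0 < T.im) (h : RVClassC κ₁ T H) : RVClass κ₁ T H :=
  fun z hz => h z hz.1 ((div_nonneg hT.le (by norm_num)).trans hz.2)

/-- ★ (ii′) TOOTH–NEST DICHOTOMY, band-state form (OPEN; instance `θ = 1/10`): frame → `StTrkDQ … j T` → θ-band partner `b` touching `T` → near
tooth `|t − Re T| ≤ Im T/2` → `RestFactor` → `RVClassC κ₁ T H` ⇒ a non-real zero of `f⁽ʲ⁺¹⁾` in `T`'s CLOSED Jensen disc, or an NL event within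
`2·Im T` of `Re T` in the law's range.  (ii) of #1275 :87 with the binder `StTrkDQ … j T` (ERRATUM-2) and the closed class. -/
def ToothNestDichotomyCQ (θ κ₁ : ℝ) : Prop :=
  ∀ (η : ℝ) (f : ℂ → ℂ) (x₀ s hmax R Hs : ℝ) (B : ℕ), EngineHyps5 2 η f x₀ s hmax R Hs B → ∀ (j : ℕ) (T b : ℂ) (t : ℝ) (H : ℂ → ℂ),
    StTrkDQ η f x₀ s hmax R Hs B j T → (1 - θ) * T.im ≤ b.im → b.im ≤ T.im → |T.re - b.re| ≤ T.im + b.im → |t - T.re| ≤ T.im / 2 →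
    RestFactor f j T b t H → RVClassC κ₁ T H →
    (∃ w : ℂ, 0 < w.im ∧ iteratedDeriv (j + 1) f w = 0 ∧ NestedStep T w) ∨
    (∃ x : ℝ, |x - x₀| < ((j : ℝ) + 3) * R / 2 ∧ |x - T.re| ≤ 2 * T.im ∧ NLEventOf f j x)

/-- ★ (iii′) UMBRELLA DICHOTOMY, band-state form (OPEN): the tooth-free twin of (ii′) over the four-body rest factor `RestFactor4`. -/
def UmbrellaDichotomyCQ (θ κ₁ : ℝ) : Prop :=
  ∀ (η : ℝ) (f : ℂ → ℂ) (x₀ s hmax R Hs : ℝ) (B : ℕ), EngineHyps5 2 η f x₀ s hmax R Hs B → ∀ (j : ℕ) (T b : ℂ) (H : ℂ → ℂ),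
    StTrkDQ η f x₀ s hmax R Hs B j T → (1 - θ) * T.im ≤ b.im → b.im ≤ T.im → |T.re - b.re| ≤ T.im + b.im →
    RestFactor4 f j T b H → RVClassC κ₁ T H →
    (∃ w : ℂ, 0 < w.im ∧ iteratedDeriv (j + 1) f w = 0 ∧ NestedStep T w) ∨
    (∃ x : ℝ, |x - x₀| < ((j : ℝ) + 3) * R / 2 ∧ |x - T.re| ≤ 2 * T.im ∧ NLEventOf f j x)

/-- (K) the typed (ii) implies (ii′): the retype only WEAKENS the law (more hypotheses; `0 < Im T` is `hT.2.2.1`, the class shrinks). -/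
theorem toothNestDichotomyC_of_Q {θ κ₁ : ℝ} (h : ToothNestDichotomyQ θ κ₁) : ToothNestDichotomyCQ θ κ₁ :=
  fun η f x₀ s hmax R Hs B hE j T b t H hT hb1 hb2 ht hn hH hRV =>
    h η f x₀ s hmax R Hs B hE j T b t H hT.2.2.1 hb1 hb2 ht hn hH (rvClass_of_rvClassC hT.2.2.1 hRV)

/-- (K) the typed (iii) implies (iii′), likewise. -/
theorem umbrellaDichotomyC_of_Q {θ κ₁ : ℝ} (h : UmbrellaDichotomyQ θ κ₁) : UmbrellaDichotomyCQ θ κ₁ :=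
  fun η f x₀ s hmax R Hs B hE j T b H hT hb1 hb2 ht hH hRV =>
    h η f x₀ s hmax R Hs B hE j T b H hT.2.2.1 hb1 hb2 ht hH (rvClass_of_rvClassC hT.2.2.1 hRV)

/-- (K) STRICT-RADIUS FORM SUFFICES for (ii′): a prover who reaches the NL branch as `|x − Re T| < 2·Im T` (no range conjunct) has (ii′) — the
range comes from `hT` by `nl_branch_of_strict` (#1275 :168). -/
theorem toothNestDichotomyC_of_strict {θ κ₁ : ℝ}
    (h : ∀ (η : ℝ) (f : ℂ → ℂ) (x₀ s hmax R Hs : ℝ) (B : ℕ), EngineHyps5 2 η f x₀ s hmax R Hs B → ∀ (j : ℕ) (T b : ℂ) (t : ℝ) (H : ℂ → ℂ),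
      StTrkDQ η f x₀ s hmax R Hs B j T → (1 - θ) * T.im ≤ b.im → b.im ≤ T.im → |T.re - b.re| ≤ T.im + b.im → |t - T.re| ≤ T.im / 2 →
      RestFactor f j T b t H → RVClassC κ₁ T H →
      (∃ w : ℂ, 0 < w.im ∧ iteratedDeriv (j + 1) f w = 0 ∧ NestedStep T w) ∨ (∃ x : ℝ, |x - T.re| < 2 * T.im ∧ NLEventOf f j x)) :
    ToothNestDichotomyCQ θ κ₁ := fun η f x₀ s hmax R Hs B hE j T b t H hT hb1 hb2 ht hn hH hRV =>
  (h η f x₀ s hmax R Hs B hE j T b t H hT hb1 hb2 ht hn hH hRV).imp_right (nl_branch_of_strict hE hT)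

/-- ★ (K) DISPATCH of (ii′) inside 2′ (`hT` passed WHOLE; rest-factor data and the closed class supplied by the caller): given `¬ ReadyR2 … j v`
the NL branch is absurd (`nl_branch_absurd`) and the nested branch is a level-(j+1) band state (`stTrkDQ_succ_of_nested`). -/
theorem succ_of_toothNestDichotomyC {θ κ₁ : ℝ} (hN : ToothNestDichotomyCQ θ κ₁)
    {η : ℝ} {f : ℂ → ℂ} {x₀ s hmax R Hs : ℝ} {B j : ℕ} {T b v : ℂ} {t : ℝ} {H : ℂ → ℂ}
    (hE : EngineHyps5 2 η f x₀ s hmax R Hs B) (hT : StTrkDQ η f x₀ s hmax R Hs B j T) (hb1 : (1 - θ) * T.im ≤ b.im) (hb2 : b.im ≤ T.im)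
    (htouch : |T.re - b.re| ≤ T.im + b.im) (hnear : |t - T.re| ≤ T.im / 2) (hH : RestFactor f j T b t H) (hRV : RVClassC κ₁ T H)
    (hnR : ¬ ReadyR2 η f x₀ s hmax R Hs B j v) : ∃ u : ℂ, StTrkDQ η f x₀ s hmax R Hs B (j + 1) u := by
  rcases hN η f x₀ s hmax R Hs B hE j T b t H hT hb1 hb2 htouch hnear hH hRV with ⟨w, hwim, hw0, hn⟩ | ⟨x, hxr, -, hNL⟩
  · exact ⟨w, stTrkDQ_succ_of_nested hE hT hw0 hwim hn⟩
  · exact (nl_branch_absurd hnR hxr hNL).elim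

/-- ★ (K) DISPATCH of (iii′) inside 2′ (four-body rest factor; no tooth). -/
theorem succ_of_umbrellaDichotomyC {θ κ₁ : ℝ} (hN : UmbrellaDichotomyCQ θ κ₁)
    {η : ℝ} {f : ℂ → ℂ} {x₀ s hmax R Hs : ℝ} {B j : ℕ} {T b v : ℂ} {H : ℂ → ℂ}
    (hE : EngineHyps5 2 η f x₀ s hmax R Hs B) (hT : StTrkDQ η f x₀ s hmax R Hs B j T) (hb1 : (1 - θ) * T.im ≤ b.im) (hb2 : b.im ≤ T.im)
    (htouch : |T.re - b.re| ≤ T.im + b.im) (hH : RestFactor4 f j T b H) (hRV : RVClassC κ₁ T H)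
    (hnR : ¬ ReadyR2 η f x₀ s hmax R Hs B j v) : ∃ u : ℂ, StTrkDQ η f x₀ s hmax R Hs B (j + 1) u := by
  rcases hN η f x₀ s hmax R Hs B hE j T b H hT hb1 hb2 htouch hH hRV with ⟨w, hwim, hw0, hn⟩ | ⟨x, hxr, -, hNL⟩
  · exact ⟨w, stTrkDQ_succ_of_nested hE hT hw0 hwim hn⟩
  · exact (nl_branch_absurd hnR hxr hNL).elim

end RhW08.Lens1ToothNestUmbrella
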